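/-
COR-CM (cell pub-hodgecm2 = stage 2 of the Hodge ladder), seat b26 gen 17 (prover-pub-hodgecm2-b26-g17-0, 2026-08-21);
count-neutral for the binder table (no row).  Capstone of `Assembly/EllipticCurveEndomorphismAlgebra` /
`Assembly/CMEllipticCurvesIsogenyFields`: the STRUCTURE THEOREM `End⁰(E) ≅ ℚ` or `End⁰(E) ≅ ℚ[X]/(X² + d) = ℚ(√-d)` for
every complex elliptic curve.  Theorems only: no definition, no notation, no named fact, no instance.
-/
import Summits.HodgeConjecture.CorCM.Assembly.CMEllipticCurvesIsogenyFields
import Literature.AlgebraicGeometry.VanGeemen1994.WeilDiscriminantOfHyperbolic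
import HarnessLib

/-!
# `End⁰(E) ≅ ℚ` or `End⁰(E) ≅ ℚ(√-d)` for every complex elliptic curve

Silverman AEC VI Thm. 5.5 / III Cor. 9.4 (characteristic `0`): the endomorphism algebra `End(E) ⊗ ℚ` of a complex
elliptic curve is `ℚ` or an imaginary quadratic field; Moonen–Zarhin (2.1), `g = 1`: Type I(1) (`End⁰ = ℚ`) or Type
IV(1,1) (`End⁰ = ` CM field).  With `Assembly/EllipticCurveEndomorphismAlgebra` (dimension `1` or `2`, commutative,
a field) and `Assembly/CMEllipticCurvesIsogenyFields` (`End⁰(E) = ℚ·1 ⊕ ℚ·ψ`, `ψ² = -d`) this file names the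
algebras, as `ℚ`-algebra isomorphisms:

* `CMQuadraticOrder.nonempty_algEquiv_adjoinRoot` (abstract algebra): a commutative non-zero `ℚ`-algebra of dimension
  `2` containing `x` with `x² = -d` (`d ≥ 1`) is `≅ K_d = ℚ[X]/(X² + d)` (the tree's `VanGeemen1994.weilField d`, a field by
  `VanGeemen1994.irreducible_X_sq_add_C`; the lift `X ↦ x` is injective from a field and bijective by dimension);
* `nonempty_algEquiv_adjoinRoot_of_cm` — **`End⁰(E) ≅ K_d = ℚ[X]/(X² + d)` for an elliptic curve with
  `ψ ≫ ψ = -(d • 𝟙 E)`** (the same `K_d` as in the tree's Weil-type files, `VanGeemen1994.weilField`);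
* `nonempty_algEquiv_rat_of_not_isOfCMType` — **`End⁰(E) ≅ ℚ` for an elliptic curve not of CM type** (and
  `nonempty_algEquiv_rat_iff_not_isOfCMType`);
* `endAlgebra_structure_of_dim_eq_one` — **the dichotomy: `End⁰(E) ≅ ℚ`, or `End⁰(E) ≅ ℚ[X]/(X² + d)` for some
  `d ≥ 1`**, the first case iff `E` is not of CM type, the second iff it is.

HONEST SCOPE: structure of `End⁰` of complex elliptic curves via Hodge theory and Riemann's theorem (tree theorems);
nothing here bears on HC_CM or on the summit.

References: [SilvermanAEC2009] J. Silverman, *The Arithmetic of Elliptic Curves*, III Cor. 9.4, VI Thm. 5.5 ·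
[MoonenZarhin1999LowDim] Math. Ann. 315 (1999), §2 (2.1) · [MumfordAV1970] §19 Cor. 2 of Thm. 1 ·
[vanGeemen1994HodgeAV] B. van Geemen, LNM 1594 (1994), Lemma 5.2 (`K = ℚ(√-d)`).
-/

noncomputable section

open CategoryTheory Module Polynomial
open Literature.AlgebraicGeometry.Motives Literature.AlgebraicGeometry.HodgeTheory
open Literature.AlgebraicGeometry.ComplexMultiplication Literature.AlgebraicGeometry.Milne1999

/-! ## §1 Algebra: a commutative two-dimensional `ℚ`-algebra with `x² = -d` is `K_d = ℚ[X]/(X² + d)` -/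

namespace Summit.HodgeConjecture.CorCM.CMQuadraticOrder

open Literature.AlgebraicGeometry.VanGeemen1994 (weilField irreducible_X_sq_add_C)

/-- `dim_ℚ K_d = 2` for `d ≥ 1` (`K_d = ℚ[X]/(X² + d)`, the tree's `VanGeemen1994.weilField d`; power basis `1, √-d`).
[cite: vanGeemen1994HodgeAV, Lemma 5.2 (2)] -/
theorem finrank_weilField {d : ℕ} (hd : 0 < d) : Module.finrank ℚ (weilField d) = 2 := by
  have hf : (X ^ 2 + C (d : ℚ) : ℚ[X]) ≠ 0 := (irreducible_X_sq_add_C hd).ne_zero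
  rw [(AdjoinRoot.powerBasis hf).finrank, AdjoinRoot.powerBasis_dim, natDegree_X_pow_add_C]

variable {R : Type*} [Ring R] [Algebra ℚ R] (x : R) {d : ℕ}

/-- **A commutative non-zero `ℚ`-algebra of dimension `2` containing `x` with `x² = -d` (`d ≥ 1`) is isomorphic to
`ℚ[X]/(X² + d) ≅ ℚ(√-d)`**: the substitution `X ↦ x` (`AdjoinRoot.liftAlgHom`) is injective, its source being a
field (`X² + d` irreducible), and bijective because both sides have dimension `2`. (Abstract `R`; instantiated at
`End⁰` of a CM elliptic curve below.) [folklore] -/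
theorem nonempty_algEquiv_adjoinRoot [Nontrivial R] [Module.Finite ℚ R] (hx : x * x = -((d : ℚ) • (1 : R)))
    (hd : 0 < d) (h2 : Module.finrank ℚ R = 2) (hcomm : ∀ a b : R, a * b = b * a) :
    Nonempty (weilField d ≃ₐ[ℚ] R) := by
  letI : CommRing R := { (inferInstance : Ring R) with mul_comm := hcomm }
  haveI : Fact (Irreducible (X ^ 2 + C (d : ℚ) : ℚ[X])) := ⟨irreducible_X_sq_add_C hd⟩
  haveI : Module.Finite ℚ (weilField d) := (AdjoinRoot.powerBasis (irreducible_X_sq_add_C hd).ne_zero).finite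
  have h1 : (Algebra.ofId ℚ R : ℚ →+* R) (d : ℚ) = (d : ℚ) • (1 : R) := by
    rw [RingHom.coe_coe, Algebra.ofId_apply, Algebra.algebraMap_eq_smul_one]
  have hroot : (X ^ 2 + C (d : ℚ) : ℚ[X]).eval₂ (Algebra.ofId ℚ R : ℚ →+* R) x = 0 := by
    rw [eval₂_add, eval₂_X_pow, eval₂_C, pow_two, hx, h1, neg_add_cancel]
  let φ : weilField d →ₐ[ℚ] R := AdjoinRoot.liftAlgHom (X ^ 2 + C (d : ℚ) : ℚ[X]) (Algebra.ofId ℚ R) x hroot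
  have hinj : Function.Injective φ := φ.toRingHom.injective
  have hdim : Module.finrank ℚ (weilField d) = Module.finrank ℚ R := by rw [finrank_weilField hd, h2]
  exact ⟨AlgEquiv.ofBijective φ (bijective_of_injective_of_finrank_eq φ hinj hdim)⟩

/-- **A non-zero `ℚ`-algebra all of whose elements are scalars is isomorphic to `ℚ`** (`Algebra.ofId` is injective
from the field `ℚ` and surjective by hypothesis). [folklore] -/
theorem nonempty_algEquiv_rat [Nontrivial R] (h : ∀ y : R, ∃ c : ℚ, y = algebraMap ℚ R c) :
    Nonempty (ℚ ≃ₐ[ℚ] R) :=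
  ⟨AlgEquiv.ofBijective (Algebra.ofId ℚ R) ⟨(algebraMap ℚ R).injective, fun y => by
    obtain ⟨c, rfl⟩ := h y; exact ⟨c, rfl⟩⟩⟩

end Summit.HodgeConjecture.CorCM.CMQuadraticOrder

/-! ## §2 The endomorphism algebra of a complex elliptic curve, named -/

namespace Summit.HodgeConjecture.CorCM.PeriodCurve

open Literature.AlgebraicGeometry.VanGeemen1994 (weilField)

variable {A : AbelianVariety ℂ} {d : ℕ} {ψ : A ⟶ A}

/-- **`End⁰(E) ≅ ℚ[X]/(X² + d) = ℚ(√-d)` for an elliptic curve with complex multiplication `ψ ≫ ψ = -(d • 𝟙 E)`**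
(`d ≥ 1`): `End⁰(E)` is commutative of dimension `2` (`endAlgebra_comm_of_dim_eq_one`,
`finrank_endAlgebra_eq_two_iff_isOfCMType`) and contains `ψ` with `ψ² = -d`. [cite: SilvermanAEC2009, VI Thm. 5.5 and III Cor. 9.4]
[cite: MoonenZarhin1999LowDim, §2 (2.1) (g = 1), Type IV(1,1)] -/
theorem nonempty_algEquiv_adjoinRoot_of_cm (hA : A.dim = 1) (hd : 0 < d) (hψ : ψ ≫ ψ = -(d • 𝟙 A)) :
    Nonempty (weilField d ≃ₐ[ℚ] A.endAlgebra) := by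
  haveI := nontrivial_endAlgebra_of_dim_eq_one hA
  haveI : Module.Finite ℚ A.endAlgebra := AbelianVariety.finiteDimensional_endAlgebra_holds A
  exact CMQuadraticOrder.nonempty_algEquiv_adjoinRoot _ (endAlgebra_of_mul_self_of_cm hψ) hd
    ((finrank_endAlgebra_eq_two_iff_isOfCMType hA).2 (isOfCMType_of_cmCurve hA hd hψ))
    (endAlgebra_comm_of_dim_eq_one hA)

/-- **`End⁰(E) ≅ ℚ(√-d)` for some `d ≥ 1`, for every elliptic curve of CM type** (the complex multiplication from
`isOfCMType_iff_exists_cm_of_dim_eq_one`). [cite: SilvermanAEC2009, VI Thm. 5.5 and III Cor. 9.4]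
[cite: Milne1999, §2 p. 54] -/
theorem exists_nonempty_algEquiv_adjoinRoot_of_isOfCMType (hA : A.dim = 1)
    (hcm : Literature.AlgebraicGeometry.Milne1999.IsOfCMType A) :
    ∃ d : ℕ, 0 < d ∧ Nonempty (weilField d ≃ₐ[ℚ] A.endAlgebra) := by
  obtain ⟨ψ, d, hd, hψ⟩ := (isOfCMType_iff_exists_cm_of_dim_eq_one hA).1 hcm
  exact ⟨d, hd, nonempty_algEquiv_adjoinRoot_of_cm hA hd hψ⟩

/-- **`End⁰(E) ≅ ℚ` for every elliptic curve NOT of CM type** (every endomorphism is a rational scalar,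
`dichotomy_of_dim_eq_one`). [cite: SilvermanAEC2009, VI Thm. 5.5 and III Cor. 9.4]
[cite: MoonenZarhin1999LowDim, §2 (2.1) (g = 1), Type I(1)] -/
theorem nonempty_algEquiv_rat_of_not_isOfCMType (hA : A.dim = 1)
    (hcm : ¬ Literature.AlgebraicGeometry.Milne1999.IsOfCMType A) : Nonempty (ℚ ≃ₐ[ℚ] A.endAlgebra) := by
  haveI := nontrivial_endAlgebra_of_dim_eq_one hA
  rcases dichotomy_of_dim_eq_one hA with ⟨h, -⟩ | ⟨-, -, -, hscal⟩
  · exact absurd h hcm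
  · exact CMQuadraticOrder.nonempty_algEquiv_rat hscal

/-- **`End⁰(E) ≅ ℚ` iff `E` is not of CM type** (an isomorphism forces dimension `1`, `finrank_endAlgebra_eq_one_iff_not_isOfCMType`).
[cite: SilvermanAEC2009, VI Thm. 5.5 and III Cor. 9.4] [cite: Milne1999, §2 p. 54] -/
theorem nonempty_algEquiv_rat_iff_not_isOfCMType (hA : A.dim = 1) :
    Nonempty (ℚ ≃ₐ[ℚ] A.endAlgebra) ↔ ¬ Literature.AlgebraicGeometry.Milne1999.IsOfCMType A := by
  refine ⟨fun ⟨e⟩ => (finrank_endAlgebra_eq_one_iff_not_isOfCMType hA).1 ?_, nonempty_algEquiv_rat_of_not_isOfCMType hA⟩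
  rw [← e.toLinearEquiv.finrank_eq, Module.finrank_self]

/-- **THE STRUCTURE OF `End⁰` OF A COMPLEX ELLIPTIC CURVE.**  For every complex abelian variety `A` of dimension `1`:
EITHER `A` is not of CM type and `End⁰(A) ≅ ℚ`, OR `A` is of CM type and `End⁰(A) ≅ ℚ[X]/(X² + d) = ℚ(√-d)` for
some `d ≥ 1` (Silverman AEC VI Thm. 5.5; Moonen–Zarhin (2.1), `g = 1`: Type I(1) versus Type IV(1,1)).
[cite: SilvermanAEC2009, VI Thm. 5.5 and III Cor. 9.4] [cite: MoonenZarhin1999LowDim, §2 (2.1) (g = 1)]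
[cite: MumfordAV1970, §19 Cor. 2 of Thm. 1 (p. 174)] -/
theorem endAlgebra_structure_of_dim_eq_one (hA : A.dim = 1) :
    (¬ Literature.AlgebraicGeometry.Milne1999.IsOfCMType A ∧ Nonempty (ℚ ≃ₐ[ℚ] A.endAlgebra)) ∨
      (Literature.AlgebraicGeometry.Milne1999.IsOfCMType A ∧
        ∃ d : ℕ, 0 < d ∧ Nonempty (weilField d ≃ₐ[ℚ] A.endAlgebra)) := by
  by_cases hcm : Literature.AlgebraicGeometry.Milne1999.IsOfCMType A
  · exact Or.inr ⟨hcm, exists_nonempty_algEquiv_adjoinRoot_of_isOfCMType hA hcm⟩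
  · exact Or.inl ⟨hcm, nonempty_algEquiv_rat_of_not_isOfCMType hA hcm⟩

end Summit.HodgeConjecture.CorCM.PeriodCurve

end
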